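import Literature.Probability.Percolation.SepArmsOnSmallRatio
import Literature.Probability.Percolation.LocallyMonotoneFKG
import HarnessLib

/-!
# Outer-landed `k`-arm events `extArmsOn κ s`: the target of the external half of Thm. 11, and its outward extension

Topic: Probability / Percolation; family `crit-perc` (critical and near-critical site percolation
on the triangular lattice `𝕋`; hexagonal annuli `Λ_N ∖ Λ_n`). A brick toward the named fact
`Literature.Probability.Percolation.Nolin2008_prop17_quasiMult` (P. Nolin, *Near-critical
percolation in two dimensions*, EJP 13 (2008), §4.5 Prop. 17 [arXiv 0711.4948: Prop. 16]) through
the pipeline `polyArmProb_quasiMult_of_sepArmsOn_separation` (`SepArmsOnQuasiMult.lean`), whose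
input is Nolin's arm-separation theorem (Thm. 11 [arXiv Thm. 10]) for the pattern `(κ, s)`. Nolin
proves Thm. 11 in two halves (§4.4: external extremities pp. 11–13, internal ones p. 13); the
external half produces arms fenced and landed on the OUTER boundary only — the events `Ã̃^{·/η,I}`,
in the tree `extOpenArm n N` for one open arm on side `0` (`ArmSeparationExtArm.lean`), assembled
for four arms as `extFourArmQ` (`σ = BWBW`) and `extFourAdjR` (`σ = BBWW`, `AdjProb.lean`). This
file DEFINES the outer-landed event for an arbitrary pattern — `k` arms of colours
`κ : Fin k → Bool` landing on the sides `s : Fin k → Fin 6` (injective), carriers of arms of the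
same colour disjoint, as for `sepArmsOn` (`SepArmsOnGlue.lean`) — and PROVES the pattern-independent
inputs of Nolin's induction on scales (§4.4; the tree's `le_mul_of_separationScheme_upto`) that
concern it:

* `extArmsOn κ s n N`, `extArmsOnCol κ s b n N`, `extArmsOn_eq_inter`, monotonicity of the
  one-colour halves, cone normalisation of the carriers (`mem_extArmsOnCol_cone`), locality
  (`determinedBy_extArmsOnCol`);
* `sepArmsOn_subset_extArmsOn` — fully fenced arms are outer-landed arms (`2n ≤ N`); hence the
  bounded-ratio estimate `pow_le_real_extArmsOn_smallRatio_at` (from `SepArmsOnSmallRatio.lean`);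
* `extArmsOn_inter_corr_subset` — **outward extension, deterministic part** (Nolin, Prop. 12 (i)
  [arXiv Prop. 11] for outer-landed arms; Kesten 1987, Lemma 2): outer-landed arms at scale `R`
  together with the bent corridors `sepOutCorrQ R R'` read in the `k` frames give outer-landed arms
  at scale `R'` (`2200 ≤ R`, `2n ≤ R`, `2R ≤ R' ≤ 32 R`), the new carriers — old carrier cut to its
  cone, plus the rotated corridor — being disjoint within a colour (the corridors and the cone tips
  beyond `Λ_R` live in the pairwise disjoint half-open sectors, `image_rot_halfSector_disjoint`);
* `real_extArmsOn_mul_pow_le_outward_at` — **outward extension at constant cost, at `p`**: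
  `P_p(extArmsOn κ s n R) · (c^95)^k ≤ P_p(extArmsOn κ s n R')` from RSW at `p` and `1 - p`
  (Nolin's Lemma 13 [arXiv Lemma 12], `triSitePercolation_locallyMonotone_fkg`, with increasing
  region the open corridors and decreasing region the closed ones; independence of the corridors of
  one colour); `exists_real_extArmsOn_mul_le_outward` — at `p = 1/2`.

Everything here is PROVED; no named fact is introduced (two definitions with bodies).

## References

* P. Nolin, *Near-critical percolation in two dimensions*, Electron. J. Probab. 13 (2008),
  1562–1623, §4.2 Def. 6–8, §4.3 Prop. 12 (i), Lemma 13, §4.4 (proof of Thm. 11, external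
  extremities) [arXiv 0711.4948: Def. 6–8, Prop. 11, Lemma 12, Thm. 10 pp. 11–13]. [Nolin2008]
* H. Kesten, *Scaling relations for 2D-percolation*, Comm. Math. Phys. 109 (1987), Lemma 2. [Kesten1987]

Tree: `extOpenArm`, `isUpperSet_extOpenArm`, `sepOpenArm_subset_extOpenArm` (`ArmSeparationExtArm.lean`);
`extConeSet`, `mem_extOpenArm_iff_inter_cone`, `sepOutCorrQ`, `sepOutCorrQFinset`,
`isUpperSet_sepOutCorrQ`, `determinedBy_sepOutCorrQ`, `sepOutCorrQFinset_subset`,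
`extOpenArm_inter_sepOutCorrQ_subset` (`ArmSeparationOutExtFour.lean`); `le_real_sepOutCorrQ_at'`
(`ArmSeparationHalfStepBoundFour.lean`); `sepArmsOn` (`SepArmsOnGlue.lean`); `sepArmAt`,
`sepOpenArmIn`, `sepOpenArm`, `readFrame`, `IsUpperSet.preimage_readFrame_true/false`,
`determinedBy_preimage_readFrame` (`ArmSeparationFourArm.lean`, `ArmSeparation.lean`);
`image_rot_halfSector_disjoint`, `real_biInter_eq_prod_of_pairwise_disjoint`,
`pow_le_real_sepArmsOn_smallRatio_at` (`SepArmsOnSmallRatio.lean`); `triSitePercolation_locallyMonotone_fkg`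
(`LocallyMonotoneFKG.lean`); `tri_rsw_half_holds` (`TriThetaHalf.lean`).
-/

noncomputable section

open MeasureTheory Set

namespace Literature.Probability.Percolation

open LatticeModels

variable {k : ℕ}

/-! ### The events -/

/-- **The outer-landed `k`-arm event with colours `κ` and landing sides `s`** (Nolin 2008, §4.4,
the events `Ã̃^{·/η,I}_{k,κ}(n, N)` of the external half of the proof of Thm. 11: arms from
`∂Λ_n`, fenced and landed on the middle half of side `s j` of `∂Λ_N` only; relaxed arm by arm as in
`extOpenArm`): carriers `X j` such that the configuration read in colour `κ j` in the frame of side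
`s j`, cut down to the pulled-back carrier, has an outer-landed open arm on side `0`; carriers of
arms of the same colour pairwise disjoint (arms of different colours are disjoint automatically). [cite: Nolin2008, §4.2 Def. 6–8 and §4.4 (arXiv 0711.4948: Def. 6–8; proof of Thm. 10, p. 13)] -/
def extArmsOn (κ : Fin k → Bool) (s : Fin k → Fin 6) (n N : ℕ) : Set (SiteConfig (Site 2)) :=
  {ω | ∃ X : Fin k → Set (Site 2), (∀ i j, i ≠ j → κ i = κ j → Disjoint (X i) (X j)) ∧
    ∀ j : Fin k, readFrame (s j).val (κ j) ω ∩ (triRotIsoPow (s j).val) ⁻¹' (X j) ∈ extOpenArm n N}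

/-- **The arms of colour `b` of `extArmsOn κ s n N`**: carriers for the indices `j` with `κ j = b` only. [cite: Nolin2008, §4.2 Def. 6–8 and §4.4 (arXiv 0711.4948: proof of Thm. 10, p. 13)] -/
def extArmsOnCol (κ : Fin k → Bool) (s : Fin k → Fin 6) (b : Bool) (n N : ℕ) : Set (SiteConfig (Site 2)) :=
  {ω | ∃ X : Fin k → Set (Site 2), (∀ i j, i ≠ j → κ i = b → κ j = b → Disjoint (X i) (X j)) ∧
    ∀ j : Fin k, κ j = b → readFrame (s j).val b ω ∩ (triRotIsoPow (s j).val) ⁻¹' (X j) ∈ extOpenArm n N}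

/-- `extArmsOn κ s` is contained in each of its one-colour halves. [folklore] -/
theorem extArmsOn_subset_extArmsOnCol (κ : Fin k → Bool) (s : Fin k → Fin 6) (b : Bool) (n N : ℕ) :
    extArmsOn κ s n N ⊆ extArmsOnCol κ s b n N := by
  rintro ω ⟨X, hX, hA⟩
  refine ⟨X, fun i j hij hi hj => hX i j hij (hi.trans hj.symm), fun j hj => ?_⟩
  have h := hA j
  rwa [hj] at h

/-- The two one-colour halves together give `extArmsOn κ s` (merge the carriers by colour). [folklore] -/
theorem extArmsOnCol_inter_subset (κ : Fin k → Bool) (s : Fin k → Fin 6) (n N : ℕ) :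
    extArmsOnCol κ s true n N ∩ extArmsOnCol κ s false n N ⊆ extArmsOn κ s n N := by
  classical
  rintro ω ⟨⟨X, hX, hA⟩, ⟨Y, hY, hB⟩⟩
  refine ⟨fun j => if κ j = true then X j else Y j, fun i j hij hκ => ?_, fun j => ?_⟩
  · dsimp only
    by_cases hi : κ i = true
    · have hj : κ j = true := hκ ▸ hi
      rw [if_pos hi, if_pos hj]
      exact hX i j hij hi hj
    · have hi' : κ i = false := by simpa using hi
      have hj' : κ j = false := hκ ▸ hi'
      have hj : ¬ κ j = true := by rw [hj']; decide
      rw [if_neg hi, if_neg hj]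
      exact hY i j hij hi' hj'
  · dsimp only
    by_cases hj : κ j = true
    · rw [if_pos hj, hj]
      exact hA j hj
    · have hj' : κ j = false := by simpa using hj
      rw [if_neg hj, hj']
      exact hB j hj'

/-- `extArmsOn κ s = (open half) ∩ (closed half)`. [folklore] -/
theorem extArmsOn_eq_inter (κ : Fin k → Bool) (s : Fin k → Fin 6) (n N : ℕ) :
    extArmsOn κ s n N = extArmsOnCol κ s true n N ∩ extArmsOnCol κ s false n N :=
  Subset.antisymm (fun _ h => ⟨extArmsOn_subset_extArmsOnCol κ s true n N h, extArmsOn_subset_extArmsOnCol κ s false n N h⟩)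
    (extArmsOnCol_inter_subset κ s n N)

/-- The open half is increasing. [folklore] -/
theorem isUpperSet_extArmsOnCol_true (κ : Fin k → Bool) (s : Fin k → Fin 6) (n N : ℕ) :
    IsUpperSet (extArmsOnCol κ s true n N) := by
  rintro ω ω' hle ⟨X, hX, hA⟩
  refine ⟨X, hX, fun j hj => isUpperSet_extOpenArm n N ?_ (hA j hj)⟩
  exact Set.inter_subset_inter_left _ (readFrame_true_mono _ hle)

/-- The closed half is decreasing. [folklore] -/
theorem isLowerSet_extArmsOnCol_false (κ : Fin k → Bool) (s : Fin k → Fin 6) (n N : ℕ) :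
    IsLowerSet (extArmsOnCol κ s false n N) := by
  rintro ω ω' hle ⟨X, hX, hA⟩
  refine ⟨X, hX, fun j hj => isUpperSet_extOpenArm n N ?_ (hA j hj)⟩
  exact Set.inter_subset_inter_left _ (readFrame_false_anti _ hle)

/-! ### Cone normalisation of the carriers and locality -/

/-- **Cutting a carrier to the cone**: if the frame configuration cut to the pulled-back carrier `P`
has an outer-landed arm, so does the one cut to `P ∩ extConeSet n N` (`2n ≤ N`; locality of
`extOpenArm` in its cone support, `mem_extOpenArm_iff_inter_cone`). [folklore] -/
theorem inter_cone_mem_extOpenArm {n N : ℕ} (hnN : 2 * n ≤ N) {χ : SiteConfig (Site 2)} {P : Set (Site 2)}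
    (h : χ ∩ P ∈ extOpenArm n N) : χ ∩ (P ∩ extConeSet n N) ∈ extOpenArm n N := by
  rw [← Set.inter_assoc]
  exact (mem_extOpenArm_iff_inter_cone hnN _).1 h

/-- **The carriers of `extArmsOnCol κ s b` may be taken inside the rotated cones**
`ρ^{s j}(extConeSet n N)` (`2n ≤ N`). [folklore] -/
theorem mem_extArmsOnCol_cone {κ : Fin k → Bool} {s : Fin k → Fin 6} {b : Bool} {n N : ℕ} (hnN : 2 * n ≤ N)
    {ω : SiteConfig (Site 2)} (h : ω ∈ extArmsOnCol κ s b n N) :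
    ∃ X : Fin k → Set (Site 2), (∀ j, X j ⊆ triRotIsoPow (s j).val '' extConeSet n N) ∧
      (∀ i j, i ≠ j → κ i = b → κ j = b → Disjoint (X i) (X j)) ∧
      ∀ j : Fin k, κ j = b → readFrame (s j).val b ω ∩ (triRotIsoPow (s j).val) ⁻¹' (X j) ∈ extOpenArm n N := by
  obtain ⟨X, hX, hA⟩ := h
  refine ⟨fun j => X j ∩ triRotIsoPow (s j).val '' extConeSet n N, fun j => inter_subset_right,
    fun i j hij hi hj => Disjoint.mono inter_subset_left inter_subset_left (hX i j hij hi hj), fun j hj => ?_⟩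
  dsimp only
  rw [Set.preimage_inter, Set.preimage_image_eq _ (triRotIsoPow (s j).val).injective]
  exact inter_cone_mem_extOpenArm hnN (hA j hj)

/-- The one-arm event "the frame configuration cut to `P` has an outer-landed arm" is determined by
the rotated cone support (`2n ≤ N`). [folklore] -/
theorem determinedBy_cut_extOpenArm (i : ℕ) (b : Bool) (P : Set (Site 2)) {n N : ℕ} (hnN : 2 * n ≤ N) :
    DeterminedBy {ω : SiteConfig (Site 2) | readFrame i b ω ∩ P ∈ extOpenArm n N}
      (triRotIsoPow i '' extConeSet n N) := by
  have h : {ω : SiteConfig (Site 2) | readFrame i b ω ∩ P ∈ extOpenArm n N} =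
      readFrame i b ⁻¹' {χ : SiteConfig (Site 2) | χ ∩ P ∈ extOpenArm n N} := rfl
  rw [h]
  refine determinedBy_preimage_readFrame i b ?_
  rw [determinedBy_iff]
  intro χ χ' hχ
  simp only [mem_setOf_eq]
  rw [mem_extOpenArm_iff_inter_cone hnN (χ ∩ P), mem_extOpenArm_iff_inter_cone hnN (χ' ∩ P)]
  have e : χ ∩ P ∩ extConeSet n N = χ' ∩ P ∩ extConeSet n N := by
    rw [Set.inter_assoc, Set.inter_comm P, ← Set.inter_assoc, hχ, Set.inter_assoc, Set.inter_comm _ P,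
      ← Set.inter_assoc]
  rw [e]

/-- **Locality of the one-colour halves**: `extArmsOnCol κ s b n N` is determined by any set of
sites containing the rotated cone supports `ρ^{s j}(extConeSet n N)` of the arms of colour `b`
(`2n ≤ N`). [folklore] -/
theorem determinedBy_extArmsOnCol (κ : Fin k → Bool) (s : Fin k → Fin 6) (b : Bool) {n N : ℕ} (hnN : 2 * n ≤ N)
    {F : Set (Site 2)} (hF : ∀ j : Fin k, κ j = b → triRotIsoPow (s j).val '' extConeSet n N ⊆ F) :
    DeterminedBy (extArmsOnCol κ s b n N) F := by
  have h : extArmsOnCol κ s b n N = ⋃ X : Fin k → Set (Site 2),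
      ⋃ (_ : ∀ i j, i ≠ j → κ i = b → κ j = b → Disjoint (X i) (X j)),
        ⋂ j : Fin k, ⋂ (_ : κ j = b),
          {ω : SiteConfig (Site 2) | readFrame (s j).val b ω ∩ (triRotIsoPow (s j).val) ⁻¹' (X j) ∈ extOpenArm n N} := by
    ext ω
    simp only [extArmsOnCol, mem_setOf_eq, mem_iUnion, mem_iInter, exists_prop]
  rw [h]
  exact DeterminedBy.iUnion fun X => DeterminedBy.iUnion fun _ =>
    DeterminedBy.iInter fun j => DeterminedBy.iInter fun hj => (determinedBy_cut_extOpenArm _ b _ hnN).mono (hF j hj)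

/-! ### Fully fenced arms are outer-landed -/

/-- A fenced arm confined to `P` gives, after cutting the configuration down to `P`, a fenced arm
(its fence crossings and joining path run inside `P`). [folklore] -/
theorem inter_mem_sepOpenArm_of_mem_sepOpenArmIn {P : Set (Site 2)} {n N : ℕ} {χ : SiteConfig (Site 2)}
    (h : χ ∈ sepOpenArmIn P n N) : χ ∩ P ∈ sepOpenArm n N := by
  obtain ⟨z, z', u, u', hz, hz', ⟨b, t, hb, ht, p₁, p₂⟩, ⟨b', t', hb', ht', p₃, p₄⟩, p₅⟩ := h
  have e : ∀ A : Set (Site 2), A ∩ P ∩ χ = A ∩ (χ ∩ P) := fun A => by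
    rw [Set.inter_assoc, Set.inter_comm P]
  refine ⟨z, z', u, u', hz, hz', ⟨b, t, hb, ht, ?_, ?_⟩, ⟨b', t', hb', ht', ?_, ?_⟩, ?_⟩
  · rw [← e]; exact p₁
  · rw [← e]; exact p₂
  · rw [← e]; exact p₃
  · rw [← e]; exact p₄
  · rw [← e]; exact p₅

/-- **Fully fenced arms are outer-landed arms**: `sepArmsOn κ s n N ⊆ extArmsOn κ s n N`
(`2n ≤ N`), with the same carriers (`sepOpenArm_subset_extOpenArm` arm by arm). [cite: Nolin2008, §4.2 Def. 6–8 (arXiv 0711.4948: Def. 6–8)] -/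
theorem sepArmsOn_subset_extArmsOn (κ : Fin k → Bool) (s : Fin k → Fin 6) {n N : ℕ} (hnN : 2 * n ≤ N) :
    sepArmsOn κ s n N ⊆ extArmsOn κ s n N := by
  rintro ω ⟨X, hX, hA⟩
  refine ⟨X, hX, fun j => ?_⟩
  have h := hA j
  rw [mem_sepArmAt] at h
  exact sepOpenArm_subset_extOpenArm hnN (inter_mem_sepOpenArm_of_mem_sepOpenArmIn h)

/-- **The outer-landed event at bounded ratio, at `p`**: `(c^100)^k ≤ P_p(extArmsOn κ s n N)` for
`1100 ≤ n`, `2n ≤ N ≤ 256 n`, `N ≤ 2 Ncap` (RSW at `p` and `1 - p`, aspect ratio `ρ ≥ 1024`), by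
`pow_le_real_sepArmsOn_smallRatio_at` and `sepArmsOn ⊆ extArmsOn` — the initial estimate of the
outer scheme for every pattern. [cite: Nolin2008, §4.4 (arXiv 0711.4948: proof of Thm. 10, first scale)] -/
theorem pow_le_real_extArmsOn_smallRatio_at (κ : Fin k → Bool) (s : Fin k → Fin 6)
    (hs : Function.Injective s) (p : unitInterval) {c : ℝ} {ρ Ncap : ℕ}
    (hrsw : ∀ q : unitInterval, (q = p ∨ q = unitInterval.symm p) →
      ∀ m : ℕ, 1 ≤ ⌊(ρ : ℝ) * m⌋₊ → m ≤ Ncap → c ≤ triLRCrossingProb q ⌊(ρ : ℝ) * m⌋₊ m)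
    (hρ : 1024 ≤ ρ) (hc : 0 ≤ c) (hc1 : c ≤ 1) {n N : ℕ} (hn : 1100 ≤ n) (hnN : 2 * n ≤ N)
    (hN : N ≤ 256 * n) (hcap : N ≤ 2 * Ncap) :
    (c ^ 100) ^ k ≤ (triSitePercolation p).real (extArmsOn κ s n N) :=
  (pow_le_real_sepArmsOn_smallRatio_at κ s hs p hrsw hρ hc hc1 hn hnN hN hcap).trans
    (measureReal_mono (sepArmsOn_subset_extArmsOn κ s hnN) (measure_ne_top _ _))

/-! ### Outward extension: the deterministic part -/

/-- A corridor site and a cone-support site beyond `Λ_R`, rotated to different sides, differ: both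
lie in the half-open sector of their side. [folklore] -/
theorem rot_cone_rot_corr_disjoint {a b : ℕ} (ha : a < 6) (hb : b < 6) (hab : a ≠ b) {n R R' : ℕ}
    (hR : 2200 ≤ R) (hRR' : 2 * R ≤ R') (hR'R : R' ≤ 32 * R) :
    Disjoint (triRotIsoPow a '' extConeSet n R) (triRotIsoPow b '' ↑(sepOutCorrQFinset R R')) := by
  rw [Set.disjoint_left]
  rintro w ⟨u, hu, rfl⟩ ⟨v, hv, huv⟩
  have hv' := sepOutCorrQFinset_subset hR hRR' hR'R (Finset.mem_coe.1 hv)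
  have hnw : triNorm (triRotIsoPow a u) = triNorm v := by rw [← huv, triNorm_rot]
  rw [triNorm_rot] at hnw
  rw [mem_extConeSet] at hu
  have hc := hu.2.2 (by rw [hnw]; exact hv'.1)
  exact Set.disjoint_left.1 (image_rot_halfSector_disjoint ha hb hab) ⟨u, ⟨hc.1.le, hc.2⟩, rfl⟩
    ⟨v, ⟨hv'.2.2.1, hv'.2.2.2⟩, huv⟩

/-- **Outward extension of outer-landed arms, deterministic part** (Nolin 2008, Prop. 12 (i)
[arXiv 0711.4948: Prop. 11] for outer-landed arms; Kesten 1987, Lemma 2): for `2200 ≤ R`, `2n ≤ R`,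
`2R ≤ R' ≤ 32R`, outer-landed arms at scale `R` whose `k` frames carry the bent corridor
`sepOutCorrQ R R'` in their colour are outer-landed arms at scale `R'`
(`extOpenArm_inter_sepOutCorrQ_subset` arm by arm; new carriers: the old one cut to its cone plus the
rotated corridor, pairwise disjoint within a colour). [cite: Nolin2008, §4.3 Prop. 12 (i) and §4.4 p. 12 (arXiv 0711.4948: Prop. 11; proof of Thm. 10, constant C₀)] -/
theorem extArmsOn_inter_corr_subset (κ : Fin k → Bool) (s : Fin k → Fin 6) (hs : Function.Injective s)
    {n R R' : ℕ} (hR : 2200 ≤ R) (hnR : 2 * n ≤ R) (hRR' : 2 * R ≤ R') (hR'R : R' ≤ 32 * R) :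
    extArmsOn κ s n R ∩ (⋂ j : Fin k, readFrame (s j).val (κ j) ⁻¹' sepOutCorrQ R R') ⊆ extArmsOn κ s n R' := by
  rintro ω ⟨⟨X, hX, hA⟩, hC⟩
  set C : Set (Site 2) := ↑(sepOutCorrQFinset R R') with hCdef
  refine ⟨fun j => (X j ∩ triRotIsoPow (s j).val '' extConeSet n R) ∪ triRotIsoPow (s j).val '' C,
    fun i j hij hκ => ?_, fun j => ?_⟩
  · have hsij : (s i).val ≠ (s j).val := fun e => hij (hs (Fin.ext e))
    refine Disjoint.union_left (Disjoint.union_right ?_ ?_) (Disjoint.union_right ?_ ?_)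
    · exact Disjoint.mono inter_subset_left inter_subset_left (hX i j hij hκ)
    · exact Disjoint.mono inter_subset_right Subset.rfl (rot_cone_rot_corr_disjoint (s i).2 (s j).2 hsij hR hRR' hR'R)
    · exact (Disjoint.mono inter_subset_right Subset.rfl
        (rot_cone_rot_corr_disjoint (s j).2 (s i).2 hsij.symm hR hRR' hR'R)).symm
    · refine Disjoint.mono ?_ ?_ (image_rot_halfSector_disjoint (s i).2 (s j).2 hsij)
      · rintro w ⟨v, hv, rfl⟩
        have h := sepOutCorrQFinset_subset hR hRR' hR'R (Finset.mem_coe.1 hv)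
        exact ⟨v, ⟨h.2.2.1, h.2.2.2⟩, rfl⟩
      · rintro w ⟨v, hv, rfl⟩
        have h := sepOutCorrQFinset_subset hR hRR' hR'R (Finset.mem_coe.1 hv)
        exact ⟨v, ⟨h.2.2.1, h.2.2.2⟩, rfl⟩
  · dsimp only
    set χ := readFrame (s j).val (κ j) ω with hχ
    set ρj := triRotIsoPow (s j).val with hρj
    have hinj : Function.Injective ρj := (triRotIsoPow (s j).val).injective
    have eP : ρj ⁻¹' ((X j ∩ ρj '' extConeSet n R) ∪ ρj '' C) = (ρj ⁻¹' (X j) ∩ extConeSet n R) ∪ C := by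
      rw [Set.preimage_union, Set.preimage_inter, Set.preimage_image_eq _ hinj, Set.preimage_image_eq _ hinj]
    rw [eP]
    -- the old arm, cut to its cone, inside the bigger configuration
    have h1 : χ ∩ (ρj ⁻¹' (X j) ∩ extConeSet n R) ∈ extOpenArm n R := inter_cone_mem_extOpenArm hnR (hA j)
    have h2 : χ ∩ ((ρj ⁻¹' (X j) ∩ extConeSet n R) ∪ C) ∈ extOpenArm n R :=
      isUpperSet_extOpenArm n R (Set.inter_subset_inter_right _ subset_union_left) h1
    -- the corridor is unchanged by the cut
    have h3 : χ ∩ ((ρj ⁻¹' (X j) ∩ extConeSet n R) ∪ C) ∈ sepOutCorrQ R R' := by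
      have hχC : χ ∈ sepOutCorrQ R R' := Set.mem_iInter.1 hC j
      refine ((determinedBy_iff _ _).1 (determinedBy_sepOutCorrQ R R') χ _ ?_).1 hχC
      ext v
      simp only [mem_inter_iff, mem_union]
      constructor
      · rintro ⟨hv, hvC⟩; exact ⟨⟨hv, Or.inr hvC⟩, hvC⟩
      · rintro ⟨⟨hv, -⟩, hvC⟩; exact ⟨hv, hvC⟩
    exact extOpenArm_inter_sepOutCorrQ_subset hR hnR hRR' hR'R ⟨h2, h3⟩

/-! ### Outward extension at constant cost -/

/-- **Outward extension of the outer-landed `k`-arm event at constant cost, at `p`** (Nolin 2008,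
proof of Thm. 11, the constant `C₀` of §4.4 p. 12; Prop. 12 (i), Lemma 13): with the RSW input at
`p` and `1 - p` (aspect ratio `ρ ≥ 64`, heights `≤ Ncap`),
`P_p(extArmsOn κ s n R) · (c^95)^k ≤ P_p(extArmsOn κ s n R')` for `2200 ≤ R`, `2n ≤ R`,
`2R ≤ R' ≤ 32R`, `R' ≤ 2 Ncap`. Proof: the generalised FKG inequality
`triSitePercolation_locallyMonotone_fkg` with `A⁺ =` the open half at scale `R`, `A⁻ =` the closed
half (supports in `Λ_{R + R/8}`, off the corridors of the other colour), `B⁺ =` the open corridors,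
`B⁻ =` the closed corridors (supports: the rotated corridors, pairwise disjoint), then the
deterministic extension `extArmsOn_inter_corr_subset`; the corridors of one colour are independent
(`real_biInter_eq_prod_of_pairwise_disjoint`), each of probability `≥ c^95` at `p` or `1 - p`
(`le_real_sepOutCorrQ_at'`). [cite: Nolin2008, §4.3 Prop. 12 (i), Lemma 13 and §4.4 p. 12 (arXiv 0711.4948: Prop. 11, Lemma 12; proof of Thm. 10)] -/
theorem real_extArmsOn_mul_pow_le_outward_at (κ : Fin k → Bool) (s : Fin k → Fin 6)
    (hs : Function.Injective s) (p : unitInterval) {c : ℝ} {ρ Ncap : ℕ}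
    (hrsw : ∀ q : unitInterval, (q = p ∨ q = unitInterval.symm p) →
      ∀ m : ℕ, 1 ≤ ⌊(ρ : ℝ) * m⌋₊ → m ≤ Ncap → c ≤ triLRCrossingProb q ⌊(ρ : ℝ) * m⌋₊ m)
    (hρ : 64 ≤ ρ) (hc : 0 ≤ c) {n R R' : ℕ} (hR : 2200 ≤ R) (hnR : 2 * n ≤ R) (hRR' : 2 * R ≤ R')
    (hR'R : R' ≤ 32 * R) (hcap : R' ≤ 2 * Ncap) :
    (triSitePercolation p).real (extArmsOn κ s n R) * (c ^ 95) ^ k ≤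
      (triSitePercolation p).real (extArmsOn κ s n R') := by
  classical
  set CF : Finset (Site 2) := sepOutCorrQFinset R R' with hCF
  set corr : Set (SiteConfig (Site 2)) := sepOutCorrQ R R' with hcorr
  -- the four events
  set Ap := extArmsOnCol κ s true n R with hAp
  set Am := extArmsOnCol κ s false n R with hAm
  set E : Fin k → Set (SiteConfig (Site 2)) := fun j => readFrame (s j).val (κ j) ⁻¹' corr with hE
  set tT : Finset (Fin k) := Finset.univ.filter fun j => κ j = true with htT
  set tF : Finset (Fin k) := Finset.univ.filter fun j => κ j = false with htF
  set Bp : Set (SiteConfig (Site 2)) := ⋂ j ∈ tT, E j with hBp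
  set Bm : Set (SiteConfig (Site 2)) := ⋂ j ∈ tF, E j with hBm
  -- the finite sets of sites
  set G : Fin k → Finset (Site 2) := fun j => CF.image (triRotIsoPow (s j).val) with hG
  set PP : Finset (Site 2) := tT.biUnion G with hPP
  set MM : Finset (Site 2) := tF.biUnion G with hMM
  set S : Finset (Site 2) := triBall (R + R / 8) \ (PP ∪ MM) with hS
  have hGcoe : ∀ j, (↑(G j) : Set (Site 2)) = triRotIsoPow (s j).val '' ↑CF := fun j => by
    rw [hG]; dsimp only; rw [Finset.coe_image]
  -- disjointness of the rotated corridors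
  have disjG : ∀ i j : Fin k, i ≠ j → Disjoint (G i) (G j) := by
    intro i j hij
    have hsij : (s i).val ≠ (s j).val := fun e => hij (hs (Fin.ext e))
    rw [← Finset.disjoint_coe, hGcoe, hGcoe]
    refine Disjoint.mono ?_ ?_ (image_rot_halfSector_disjoint (s i).2 (s j).2 hsij)
    · rintro w ⟨v, hv, rfl⟩
      have h := sepOutCorrQFinset_subset hR hRR' hR'R (Finset.mem_coe.1 hv)
      exact ⟨v, ⟨h.2.2.1, h.2.2.2⟩, rfl⟩
    · rintro w ⟨v, hv, rfl⟩
      have h := sepOutCorrQFinset_subset hR hRR' hR'R (Finset.mem_coe.1 hv)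
      exact ⟨v, ⟨h.2.2.1, h.2.2.2⟩, rfl⟩
  have hPM : Disjoint PP MM := by
    rw [hPP, hMM, Finset.disjoint_biUnion_left]
    intro i hi
    rw [Finset.disjoint_biUnion_right]
    intro j hj
    refine disjG i j fun e => ?_
    rw [htT, Finset.mem_filter] at hi
    rw [htF, Finset.mem_filter] at hj
    rw [e] at hi
    rw [hi.2] at hj
    exact Bool.noConfusion hj.2
  have hSP : Disjoint S PP := by
    rw [hS]; exact Finset.disjoint_of_subset_right Finset.subset_union_left Finset.sdiff_disjoint
  have hSM : Disjoint S MM := by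
    rw [hS]; exact Finset.disjoint_of_subset_right Finset.subset_union_right Finset.sdiff_disjoint
  -- the cone supports lie in `Λ_{R + R/8}` and off the corridors of the other colour
  have hRcoe : (R : ℤ) + (R / 8 : ℕ) = ((R + R / 8 : ℕ) : ℤ) := by push_cast; ring
  have cone_ball : ∀ j : Fin k, triRotIsoPow (s j).val '' extConeSet n R ⊆ ↑(triBall (R + R / 8)) := by
    rintro j w ⟨v, hv, rfl⟩
    rw [Finset.mem_coe, mem_triBall_iff, triNorm_rot]
    rw [mem_extConeSet] at hv
    have := hv.2.1
    omega
  have cone_off : ∀ i j : Fin k, κ i ≠ κ j → Disjoint (triRotIsoPow (s i).val '' extConeSet n R) ↑(G j) := by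
    intro i j hκ
    have hij : i ≠ j := fun e => hκ (e ▸ rfl)
    have hsij : (s i).val ≠ (s j).val := fun e => hij (hs (Fin.ext e))
    rw [hGcoe]
    exact rot_cone_rot_corr_disjoint (s i).2 (s j).2 hsij hR hRR' hR'R
  have suppT : ∀ j : Fin k, κ j = true → triRotIsoPow (s j).val '' extConeSet n R ⊆ (↑S ∪ ↑PP : Set (Site 2)) := by
    intro j hj w hw
    by_cases hwP : w ∈ PP
    · exact Or.inr hwP
    · refine Or.inl ?_
      rw [hS, Finset.coe_sdiff, Finset.coe_union]
      refine ⟨cone_ball j hw, fun h => ?_⟩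
      rcases h with h | h
      · exact hwP h
      · rw [hMM, Finset.coe_biUnion] at h
        obtain ⟨i, hi, hwi⟩ := Set.mem_iUnion₂.1 h
        rw [Finset.mem_coe, htF, Finset.mem_filter] at hi
        have hκ : κ j ≠ κ i := by rw [hj, hi.2]; decide
        exact Set.disjoint_left.1 (cone_off j i hκ) hw hwi
  have suppF : ∀ j : Fin k, κ j = false → triRotIsoPow (s j).val '' extConeSet n R ⊆ (↑S ∪ ↑MM : Set (Site 2)) := by
    intro j hj w hw
    by_cases hwM : w ∈ MM
    · exact Or.inr hwM
    · refine Or.inl ?_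
      rw [hS, Finset.coe_sdiff, Finset.coe_union]
      refine ⟨cone_ball j hw, fun h => ?_⟩
      rcases h with h | h
      · rw [hPP, Finset.coe_biUnion] at h
        obtain ⟨i, hi, hwi⟩ := Set.mem_iUnion₂.1 h
        rw [Finset.mem_coe, htT, Finset.mem_filter] at hi
        have hκ : κ j ≠ κ i := by rw [hj, hi.2]; decide
        exact Set.disjoint_left.1 (cone_off j i hκ) hw hwi
      · exact hwM h
  -- locality and monotonicity of the four events
  have dAp : DeterminedBy Ap (↑S ∪ ↑PP) := determinedBy_extArmsOnCol κ s true hnR suppT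
  have dAm : DeterminedBy Am (↑S ∪ ↑MM) := determinedBy_extArmsOnCol κ s false hnR suppF
  have dE : ∀ j, DeterminedBy (E j) ↑(G j) := fun j => by
    rw [hGcoe]; exact determinedBy_preimage_readFrame _ _ (determinedBy_sepOutCorrQ R R')
  have dBp : DeterminedBy Bp ↑PP := by
    rw [hBp, hPP, Finset.coe_biUnion]
    refine DeterminedBy.iInter fun j => DeterminedBy.iInter fun hj => (dE j).mono ?_
    exact Set.subset_iUnion₂ (s := fun i (_ : i ∈ tT) => (↑(G i) : Set (Site 2))) j hj
  have dBm : DeterminedBy Bm ↑MM := by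
    rw [hBm, hMM, Finset.coe_biUnion]
    refine DeterminedBy.iInter fun j => DeterminedBy.iInter fun hj => (dE j).mono ?_
    exact Set.subset_iUnion₂ (s := fun i (_ : i ∈ tF) => (↑(G i) : Set (Site 2))) j hj
  have uAp : IsUpperSet Ap := isUpperSet_extArmsOnCol_true κ s n R
  have lAm : IsLowerSet Am := isLowerSet_extArmsOnCol_false κ s n R
  have uBp : IsUpperSet Bp := by
    refine isUpperSet_iInter₂ fun j hj => ?_
    rw [htT, Finset.mem_filter] at hj
    rw [hE]; dsimp only; rw [hj.2]
    exact IsUpperSet.preimage_readFrame_true _ (isUpperSet_sepOutCorrQ R R')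
  have lBm : IsLowerSet Bm := by
    refine isLowerSet_iInter₂ fun j hj => ?_
    rw [htF, Finset.mem_filter] at hj
    rw [hE]; dsimp only; rw [hj.2]
    exact IsUpperSet.preimage_readFrame_false _ (isUpperSet_sepOutCorrQ R R')
  -- Nolin's Lemma 13
  have fkg := triSitePercolation_locallyMonotone_fkg p hSP hSM hPM uAp lAm uBp lBm dAp dAm dBp dBm
  -- the corridors: independence within a colour, RSW for each
  have hone : ∀ j, c ^ 95 ≤ (triSitePercolation p).real (E j) := by
    intro j
    rw [hE]; dsimp only
    cases κ j
    · have e : readFrame (s j).val false ⁻¹' corr = compl ⁻¹' (rotConfig (s j).val ⁻¹' corr) := by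
        ext ω; simp only [mem_preimage, readFrame_false]
      rw [e]
      unfold triSitePercolation
      rw [sitePercolation_real_preimage_compl]
      have h := real_preimage_rotConfig (unitInterval.symm p) (s j).val corr
      unfold triSitePercolation at h
      rw [h]
      exact le_real_sepOutCorrQ_at' _ (hrsw _ (Or.inr rfl)) hρ hc hR hRR' hR'R hcap
    · have e : readFrame (s j).val true ⁻¹' corr = rotConfig (s j).val ⁻¹' corr := by
        ext ω; simp only [mem_preimage, readFrame_true]
      rw [e, real_preimage_rotConfig]
      exact le_real_sepOutCorrQ_at' _ (hrsw _ (Or.inl rfl)) hρ hc hR hRR' hR'R hcap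
  have prodT := real_biInter_eq_prod_of_pairwise_disjoint p tT E G (fun j _ => dE j) (fun i _ j _ hij => disjG i j hij)
  have prodF := real_biInter_eq_prod_of_pairwise_disjoint p tF E G (fun j _ => dE j) (fun i _ j _ hij => disjG i j hij)
  have hc95 : 0 ≤ c ^ 95 := pow_nonneg hc _
  have hBp_ge : (c ^ 95) ^ tT.card ≤ (triSitePercolation p).real Bp := by
    rw [hBp, prodT, ← Finset.prod_const]
    exact Finset.prod_le_prod (fun _ _ => hc95) fun j _ => hone j
  have hBm_ge : (c ^ 95) ^ tF.card ≤ (triSitePercolation p).real Bm := by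
    rw [hBm, prodF, ← Finset.prod_const]
    exact Finset.prod_le_prod (fun _ _ => hc95) fun j _ => hone j
  have hcard : tT.card + tF.card = k := by
    rw [htT, htF]
    have h := Finset.card_filter_add_card_filter_not (s := (Finset.univ : Finset (Fin k))) (p := fun j => κ j = true)
    have e : (Finset.univ.filter fun j => ¬ κ j = true) = Finset.univ.filter fun j : Fin k => κ j = false := by
      ext j; simp
    rw [e, Finset.card_univ, Fintype.card_fin] at h
    exact h
  -- the inclusions
  have hA : extArmsOn κ s n R = Ap ∩ Am := extArmsOn_eq_inter κ s n R
  have hB : Bp ∩ Bm ⊆ ⋂ j : Fin k, E j := by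
    rintro ω ⟨hT, hF⟩
    refine Set.mem_iInter.2 fun j => ?_
    cases hj : κ j
    · exact Set.mem_iInter₂.1 hF j (by rw [htF, Finset.mem_filter]; exact ⟨Finset.mem_univ _, hj⟩)
    · exact Set.mem_iInter₂.1 hT j (by rw [htT, Finset.mem_filter]; exact ⟨Finset.mem_univ _, hj⟩)
  have hsub : Ap ∩ Am ∩ (Bp ∩ Bm) ⊆ extArmsOn κ s n R' := by
    rintro ω ⟨hAω, hBω⟩
    rw [← hA] at hAω
    exact extArmsOn_inter_corr_subset κ s hs hR hnR hRR' hR'R ⟨hAω, hB hBω⟩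
  calc (triSitePercolation p).real (extArmsOn κ s n R) * (c ^ 95) ^ k
      = (triSitePercolation p).real (Ap ∩ Am) * ((c ^ 95) ^ tT.card * (c ^ 95) ^ tF.card) := by
        rw [hA, ← pow_add, hcard]
    _ ≤ (triSitePercolation p).real (Ap ∩ Am) *
          ((triSitePercolation p).real Bp * (triSitePercolation p).real Bm) :=
        mul_le_mul_of_nonneg_left (mul_le_mul hBp_ge hBm_ge (by positivity) measureReal_nonneg) measureReal_nonneg
    _ ≤ (triSitePercolation p).real (Ap ∩ Am ∩ (Bp ∩ Bm)) := fkg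
    _ ≤ (triSitePercolation p).real (extArmsOn κ s n R') := measureReal_mono hsub (measure_ne_top _ _)

/-- **Outward extension at constant cost, at criticality**: there is `c₁ > 0` with
`P_{1/2}(extArmsOn κ s n R) · c₁ ≤ P_{1/2}(extArmsOn κ s n R')` for `2200 ≤ R`, `2n ≤ R`,
`2R ≤ R' ≤ 32R` (`tri_rsw_half_holds` at aspect ratio `64`). [cite: Nolin2008, §4.3 Prop. 12 (i) and §4.4 p. 12 (arXiv 0711.4948: Prop. 11; proof of Thm. 10, constant C₀)] -/
theorem exists_real_extArmsOn_mul_le_outward (κ : Fin k → Bool) (s : Fin k → Fin 6)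
    (hs : Function.Injective s) :
    ∃ c₁ : ℝ, 0 < c₁ ∧ ∀ n R R' : ℕ, 2200 ≤ R → 2 * n ≤ R → 2 * R ≤ R' → R' ≤ 32 * R →
      (triSitePercolation half).real (extArmsOn κ s n R) * c₁ ≤
        (triSitePercolation half).real (extArmsOn κ s n R') := by
  obtain ⟨c, hc, h⟩ := tri_rsw_half_holds ((64 : ℕ) : ℝ) (by norm_num)
  refine ⟨(c ^ 95) ^ k, by positivity, fun n R R' hR hnR hRR' hR'R => ?_⟩
  refine real_extArmsOn_mul_pow_le_outward_at κ s hs half (ρ := 64) (Ncap := R') ?_ le_rfl hc.le hR hnR hRR' hR'R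
    (by omega)
  intro q hq m hm _
  have hq' : q = half := by
    rcases hq with rfl | rfl
    · rfl
    · exact symm_half
  rw [hq']
  exact (h m hm).1

end Literature.Probability.Percolation

end
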